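import Literature.Computability.Cryptography.HallgrenPell
import Literature.Computability.QuantumComplexity.CWrapAssembly
import Literature.Computability.Complexity.BrickAlgebra
import HarnessLib

/-!
# Hallgren's regulator theorem: the self-delimiting form implies the prefix form

Topic `Computability/Cryptography`; proof companion of `HallgrenPell.lean` (file `HallgrenPellPlainProofs.lean`; an earlier copy under the name `HallgrenPellProofs.lean`, p62826, was superseded in the tree by an unrelated file of that name). Theorem-only file (no
definitions, no named facts).

`HallgrenPell.lean` states Hallgren's theorem (Jozsa 2003, Thm. 7: the regulator of `ℚ(√d)` in
quantum polynomial time) in two output conventions: `Hallgren2007_regulator_qsolvable` (the answer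
`bin m`, `m ∈ {⌊R⌋, ⌈R⌉}`, as a bare PREFIX of the measured string) and
`Hallgren2007_regulator_qsolvable_delim` (the answer in the tree's pair convention
`y = ⟨bin m, w⟩`). This file proves the expected implication

* **`Hallgren2007_regulator_qsolvable_of_delim`**: delim ⇒ prefix,

by the tree's PROVED principle "deterministic polynomial-time post-processing is free inside
bounded-error quantum search" (`isQSolvable_classicalWrap_holds`, `QuantumComplexity/CWrapAssembly.lean`;
Bernstein–Vazirani 1997, §8), with the post-processor `g ⟨x, y⟩ = fst y` (`fstF ∘ sndF ∈ FP`): for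
every admissible field `K` the delimited output decomposes uniquely as `⟨bin m_K, w_K⟩`, so `fst y`
is `bin m_K` for ALL such `K` at once. Consequently the self-delimiting form is the one to
discharge; the prefix form (the statement other files cite) follows.

## References

* R. Jozsa, *Notes on Hallgren's efficient quantum algorithm for solving Pell's equation*,
  arXiv:quant-ph/0302134 (2003), §10 Thm. 7. [Jozsa2003]
* E. Bernstein, U. Vazirani, *Quantum complexity theory*, SIAM J. Comput. 26 (1997), §8.
  [BernsteinVazirani1997]
-/

noncomputable section

namespace Literature.Computability.Cryptography

open _root_.Computability Literature.Computability.Complexity Literature.Computability.Complexity.Brick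

/-- **The self-delimiting form of Hallgren's theorem implies the prefix form**: post-process the
measured string `⟨x, y⟩ ↦ fst y` (polynomial time) inside the quantum search
(`isQSolvable_classicalWrap_holds`), and note that `y = ⟨bin m, w⟩` determines `m` uniquely, the
same for every admissible `K`. [cite: Jozsa2003, §10 Thm. 7] [cite: BernsteinVazirani1997, §8] -/
theorem Hallgren2007_regulator_qsolvable_of_delim (h : Hallgren2007_regulator_qsolvable_delim) :
    Hallgren2007_regulator_qsolvable := by
  -- wrap with `h = id`, `g = fstF ∘ sndF`
  have hwrap := isQSolvable_classicalWrap_holds (fun x => x) (fstF ∘ sndF)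
    (PolyTimeComputable.id _) (comp_mem_FP fstF_mem_FP sndF_mem_FP) h
  refine hwrap.mono fun x z hz => ?_
  simp only [Set.mem_setOf_eq] at hz ⊢
  obtain ⟨y, hy, hpre⟩ := hz
  intro K _ _ hsf h2 hrank hα
  obtain ⟨m, w, hm, rfl⟩ := hy K hsf h2 hrank hα
  have hg : (fstF ∘ sndF) (boolPair x (boolPair (encodeNat m) w)) = encodeNat m := by
    simp [Function.comp]
  rw [hg] at hpre
  rcases hm with rfl | rfl
  · exact Or.inl hpre
  · exact Or.inr hpre

end Literature.Computability.Cryptography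

end
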